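import Summits.MatrixMultiplication.OmegaCensus.SmallFormats.MatMul22nRankGF5XCapSystem
import HarnessLib

/-!
# ω-census family (a): dictionary A1 — transpose check of `xcapSys5`, rows `0 … 199`

Cell `pub-omega` (unit `pub-omega-tensor-g7`), topic `Summits/MatrixMultiplication/OmegaCensus` (sub-folder `SmallFormats`).
Framing (verbatim): lottery ticket; floor = certified bounds/negative ranges. HONEST FRAMING: `decide +kernel` bookkeeping for the
kernel replay of the slack-2 X-cap certificate (transpose, part 1), split across files to respect the gate's elaboration budget.
Nothing here is progress on `ω`.
-/

namespace Summit.MatrixMultiplication.OmegaCensus.SmallFormats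

open Matrix

set_option maxRecDepth 100000 in
set_option maxHeartbeats 4000000 in
/-- Transpose check, rows `0 ≤ r < 50`. -/
theorem xcapSys5_A_eq_0 : ∀ r : Fin 498, 0 ≤ r.val ∧ r.val < 50 → ∀ j : Fin 157, xcapSys5.A r.val j.val = rowCoef5 r.val j.val := by
  decide +kernel

set_option maxRecDepth 100000 in
set_option maxHeartbeats 4000000 in
/-- Transpose check, rows `50 ≤ r < 100`. -/
theorem xcapSys5_A_eq_1 : ∀ r : Fin 498, 50 ≤ r.val ∧ r.val < 100 → ∀ j : Fin 157, xcapSys5.A r.val j.val = rowCoef5 r.val j.val := by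
  decide +kernel

set_option maxRecDepth 100000 in
set_option maxHeartbeats 4000000 in
/-- Transpose check, rows `100 ≤ r < 150`. -/
theorem xcapSys5_A_eq_2 : ∀ r : Fin 498, 100 ≤ r.val ∧ r.val < 150 → ∀ j : Fin 157, xcapSys5.A r.val j.val = rowCoef5 r.val j.val := by
  decide +kernel

set_option maxRecDepth 100000 in
set_option maxHeartbeats 4000000 in
/-- Transpose check, rows `150 ≤ r < 200`. -/
theorem xcapSys5_A_eq_3 : ∀ r : Fin 498, 150 ≤ r.val ∧ r.val < 200 → ∀ j : Fin 157, xcapSys5.A r.val j.val = rowCoef5 r.val j.val := by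
  decide +kernel

end Summit.MatrixMultiplication.OmegaCensus.SmallFormats
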